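import Mathlib
import HarnessLib
import HarnessLib.Audit
import Summits.CriticalPhenomena.Statement
import Literature.Probability.RandomPlanarGeometry.ChordalCurveFamily
import Literature.Probability.RandomPlanarGeometry.LoopSpaceMaps
import Summits.CriticalPhenomena.SAWScalingLimit.Theorems.SAWPoissonBanksLSWSimpleRestrictionIsSLE
import HarnessLib.Audit.Status.Attr

/-!
Route: SAWInfinitesimalRigidity

# Route SAWInfinitesimalRigidity — linearise R* — SLE(8/3) is locally rigid among exact
restriction–Markov families (tangent space = stretches, implicit function), plus an honest global
residue

It suffices to show X = LocalRigidity ∧ GlobalFromLocal ∧ LimitExists ∧ AxiomsOfLimit (card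
graded-infinitesimal-rigidity, realised as the
LOCAL half of the rigidity conjecture R* of route SAWRestrictionRigidity plus an explicitly named
global residue; the lattice half is shared
verbatim with that route). LocalRigidity (new, continuum): given the chordal SLE(8/3) family F,
there is ε > 0 such that every chordal
family P with the lattice-EXACT axioms — two-sided restriction, restriction-coupled domain Markov
kernel, reversibility, covariance under
z ↦ r·i^k·z + w and conjugation, carried by simple boundary-avoiding curves — whose sub-domain
avoidance probabilities are uniformly
ε-close to those of F (sup over nested Dobrushin pairs D' ⊆ D of |P_D(γ ⊆ cl D') − F_D(γ ⊆ cl D')| ≤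
ε) is conformally covariant (hence = F
by Lawler–Schramm–Werner). Mechanism (the card): the tangent space of the axiom variety at F in
dilation weight 0 is sym₀(2) (linear
stretches, IR0), the quarter-turn acts on it by −1, and an implicit-function argument integrates
"infinitesimally rigid mod GL₂" to
"isolated under D4". GlobalFromLocal: LocalRigidity → R* (stmt-CriticalPhenomena-1368 verbatim) —
the global residue, no mechanism
claimed. LimitExists, AxiomsOfLimit: the full SAW scaling limit exists as a chordal family and
inherits the exact axioms (shared items
stmt-CriticalPhenomena-1371, -1370).
Lean: `LocalRigidity ∧ GlobalFromLocal ∧ LimitExists ∧ AxiomsOfLimit`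

## Assembly
Deciding theorem (D-0027 §2.1, route repair 2026-08-15, certified sorry-free with axioms
propext/Classical.choice/Quot.sound):
`closes : LocalRigidity → GlobalFromLocal → AxiomsOfLimit → LimitExists → LSWRestrictionFact83 →
SAWScalingLimit` — take P from
LimitExists; AxiomsOfLimit gives the six axiom clauses; GlobalFromLocal applied to LocalRigidity
gives R*, hence P.IsConformallyCovariant;
LSWRestrictionFact83 (the HYPOTHESIS-FREE LSW03 classification, shared item
stmt-CriticalPhenomena-3017, closable at once by the library
theorem Literature.Probability.RandomPlanarGeometry.LawlerSchrammWerner2003_holds) gives IsSLELaw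
(8/3) D (P D) = law of an SLE curve Γ;
integral_map turns TendstoLaw … id (P D) into TendstoLaw … Γ preWienerMeasure; a.e.-measurability of
γ ↦ γ.curve is
SAW.aemeasurable_curve. No named Literature fact is a hypothesis: the former items
LSWRestrictionFact (stmt-0775, which carried the
cite-only all-κ fact exists_isSLECurve ⇔ SLE₈ trace theorem, and IsSLECurve.map_eq, in front) and
the old Assembly (stmt-4618) are
dropped from this route as not load-bearing.

Rationale: WHY THIS LINE. R* (route SAWRestrictionRigidity, r2) is a global classification with "no technique
known"; its derivative at the known solution is a
LINEAR, graded, computable problem: linearising exact restriction turns the multiplicative avoidance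
cocycle f(D;D') = Φ'^{5/8} into an
additive one, the restriction-coupled Markov identity becomes an explicit integral equation through
the Loewner description of SLE(8/3)
(LawlerSchrammWerner2003Restriction Thm 6.1; FriedrichWerner2003 and BauerBernard2003/Kytola2007 are
the CONFORMAL tangent theories this
de-conformalises), and Weil's "H¹ = known moduli ⇒ local rigidity" (Weil1964Rigidity) with a
Nash–Moser-type implicit function theorem
(Hamilton1982NashMoser) turns IR0 into LocalRigidity; Beffara2008Universal's linear modulus is
exactly the predicted weight-0 tangent
space, on which the ℤ² quarter-turn acts by −1. Imported areas: deformation/rigidity theory of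
discrete groups (tangent-space-first),
hard implicit function theorems, Virasoro/restriction representation theory as the sanity dictionary
(weights 0 and 4/3 = 2 − x_ε).
What it adds to the sibling route and the negatives index: a strictly weaker, method-backed
continuum crux (a refutation of
LocalRigidity refutes R*; a proof settles R* near SLE(8/3)), a finite-rank numerical falsifier
(nullity of the truncated linearised
system), and no new lattice statement (the refuted all-δ tightness stmt-0772 is not touched; lattice
items are the shared eventual forms).

RANKED CRUXES. #2 LocalRigidity (crux) — LOCAL RIGIDITY of SLE(8/3) (card items IR0 + LocalRigidity,
conclusion form): for every chordal family F all of whose laws are chordal SLE(8/3) laws there is ε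
> 0 such that every chordal family P that is chordal, has two-sided restriction, a
restriction-coupled domain Markov kernel, is reversible, is covariant under z ↦ r·i^k·z + w (r > 0,
k ∈ ℕ, w ∈ ℂ) and under conjugation, is carried by simple curves meeting ∂D only at a, b (the
hypotheses of stmt-CriticalPhenomena-1368 verbatim), AND satisfies sup over nested Dobrushin pairs
D' ⊆ D (same marked points) of |P D {γ ⊆ cl D'} − F D {γ ⊆ cl D'}| ≤ ε, is conformally covariant.
Intended proof: tangent space at F in weight 0 = sym₀(2) (IR0, filed informally after open),
quarter-turn acts by −1 on it, implicit function theorem on the axiom variety. [difficulty: XL] (why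
it might fail: An exotic weight-0 restriction–Markov cocycle at SLE(8/3) may exist and integrate
(T_0 never computed); the c=0 log-partner of the stress tensor may put a Jordan block at weight 0;
the sup-avoidance topology may lose derivatives so no implicit-function argument closes.)
[LawlerSchrammWerner2003Restriction, FriedrichWerner2003, BauerBernard2003, Kytola2007,
Weil1964Rigidity, Hamilton1982NashMoser, Beffara2008Universal]
#4 GlobalFromLocal (crux) — the global residue: LocalRigidity implies R* — every chordal family with
the lattice-exact axioms (hypotheses of stmt-CriticalPhenomena-1368 verbatim: chordal, restriction,
restriction-coupled Markov kernel, reversible, lattice-similarity and conjugation covariant, simple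
boundary-avoiding) is conformally covariant. Equivalent, given LocalRigidity, to "the D4-symmetric
axiom variety has no component away from SLE(8/3)"; this route claims no mechanism for it and states
it so that R* = LocalRigidity ∧ GlobalFromLocal is decomposed honestly (rank 3 is reserved for the
informal engine IR0 filed right after open). [deps: LocalRigidity] [difficulty: open-problem] (why
it might fail: No mechanism: local rigidity gives no handle on solution components far from
SLE(8/3); one anisotropic restriction–Markov family with all lattice symmetries (¬R*, stmt-1368)
refutes it while LocalRigidity survives.) [LawlerSchrammWerner2003Restriction, Beffara2008Universal,
Werner2007, LawlerSchrammWerner2004SAW]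
#5 AxiomsOfLimit (crux) — verbatim the shared item stmt-CriticalPhenomena-1370 (route
SAWRestrictionRigidity): every chordal family P that is the full scaling limit of the critical δℤ²
SAW laws — for every Dobrushin domain and every endpoint approximation — satisfies the lattice-exact
axioms: restriction, restriction-coupled Markov kernel, reversibility, covariance under z ↦ r·i^k·z
+ w and conjugation, simplicity and boundary avoidance. [difficulty: L] (why it might fail: Markov
passage needs stability of SAW limits in slit domains perturbed near the tip (beyond (lim) on Jordan
domains); simplicity/boundary avoidance need no-crawling estimates not in print; restriction passage
needs null touching; largest-component bookkeeping.) [LawlerSchrammWerner2004SAW, Werner2007,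
KennedyLawler2013, DuminilCopinHammond2013]
#6 LimitExists (crux) — verbatim the shared item stmt-CriticalPhenomena-1371 (route
SAWRestrictionRigidity): existence of the full scaling limit of the critical δℤ² SAW as a chordal
curve family (∃ P chordal with (lim) for every Dobrushin domain and every endpoint approximation;
the limit is not identified here). [difficulty: XL] (why it might fail: Eventual tightness of
critical SAW is open (no annulus-crossing bound at x_c); uniqueness of subsequential limits rests on
an avoidance-cocycle limit; an approximation-dependent limit (Kennedy–Lawler boundary effects) would
refute the conjunct itself as typed.) [LawlerSchrammWerner2004SAW, KemppainenSmirnov2017,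
AizenmanBurchardDuke1999, DuminilCopinHammond2013, KennedyLawler2013]
#9 LSWRestrictionFact83 (support) — verbatim the shared item stmt-CriticalPhenomena-3017
(Lawler–Schramm–Werner 2003, p.5 result 2, transposed, HYPOTHESIS-FREE form): a chordal family that
is chordal, conformally covariant (ChordalFamily.IsConformallyCovariant), has two-sided restriction
(ChordalFamily.IsRestriction) and is carried by simple curves meeting ∂D only at the marked points
is SLE(8/3) in every domain (IsSLELaw (8/3)). Replaces stmt-0775 in this route (route repair
2026-08-15): the all-κ existence fact exists_isSLECurve is cite-only (⇔ SLE₈ trace theorem) and not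
needed at κ = 8/3. [difficulty: provable-now — one line in a Theorems file importing
Literature.Probability.RandomPlanarGeometry.ConformalRestrictionHolds: `fun P hP hcc hres hs =>
Literature.Probability.RandomPlanarGeometry.LawlerSchrammWerner2003_holds P hP hcc hres hs` (checked
in the planner's Sketch.lean, axioms propext/Classical.choice/Quot.sound)]
[LawlerSchrammWerner2003Restriction, RohdeSchramm2005]

TWO-LAYER PLAN. LocalRigidity ⇐ InfinitesimalRigidity → ImplicitFunctionStep → LocalRigidity
(InfinitesimalRigidity = IR0, filed informally at open
pending the definition RestrictionMarkovTangentSpace; ImplicitFunctionStep = "IR0 (+ closed range of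
the linearised operator) ⇒ isolation",
Nash–Moser if derivatives are lost). LimitExists ⇐ EventualTight → UniqueSubsequentialLimits →
LimitExists and AxiomsOfLimit ⇐
{restriction+reversal+covariance passage, Markov passage, simplicity} exactly as foreseen in the
sibling route (shared children).
GlobalFromLocal is not split until LocalRigidity closes.

KILL CRITERIA. ¬LocalRigidity (an explicit one-parameter family of exact restriction–Markov,
reversible, D4/dilation/translation-covariant simple
families through SLE(8/3), e.g. integrated from a stable exotic null vector of the truncated
linearised system) closes the route
`refuted:LocalRigidity` AND refutes R* (stmt-1368) for the sibling route. ¬GlobalFromLocal (an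
exotic family far from SLE(8/3)) closes
this route and SAWRestrictionRigidity alike but leaves LocalRigidity as a theorem target of
independent interest (pivot: hand it to the
homotopy cards charge-continuation-from-lerw-lambda-saw / ising-anchored-loop-fugacity-flow as their
endpoint-pinning lemma). R* proved
directly moots LocalRigidity+GlobalFromLocal (close `superseded`). ¬LimitExists by
approximation-dependence refutes the conjunct as typed.

NOT DECOMPOSED YET. IR0 itself is filed as an informal crux (no tangent-space notion in Lean yet);
IRgap (D4-even spin-0 deformations vanish for all weights
y > −2 except the fugacity direction y = 4/3; the spectrum dictionary y = 2 − Δ) and the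
quarter-turn sign lemma (R M R⁻¹ = −M on sym₀(2))
are layer-2 material under LocalRigidity; the Banach norm for the implicit function theorem
(weighted sup over hulls vs Hölder in the hull)
is deliberately left to the prover; no lattice statement beyond the shared ones.

CHEAPEST FALSIFIER. The truncated NULLITY computation of the card (kit, small): hulls =
vertical/oblique slits and ≤ k-vertex bumps in ℍ, pasts = straight slits;
assemble the linearised (restriction + Markov-kernel + reversal + translation/dilation) constraints
at Mellin weight y = 0 as a finite
homogeneous linear system in the Taylor coefficients of the additive cocycle g (entries:
Schwarz–Christoffel / hypergeometric numbers from
Φ'_A(0)^{5/8} and the Loewner maps); nullity must stabilise at 2 (pure spin 2) as k grows. Nullity >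
2 with a D4-even null vector stable
under truncation kills IR0 and puts LocalRigidity/R* in doubt; not run this session (kit not in the
plancard budget) — first refuter task.

NUMBERS. Weight-0 tangent space predicted: dimension 2, spin ±2 (sym₀(2) = Beffara's modulus;
Beffara2008Universal Prop. 4). Relevant D4-even
direction: weight 4/3 = 1 + κ/8 = 2 − x_ε, x_ε = 2/3 (fugacity/massive tilt; MakarovSmirnov2010).
First D4-even irrelevant weight −2
(Δ = 4: TT̄, spin-4 lattice operator; correction exponent Δ₁ = 3/2 measured, no 11/16 term:
CaraccioloEtAl2005). Restriction exponent 5/8,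
c = 0, c'(8/3) = 15/8 ≠ 0 (d/dκ is not tangent). ε of LocalRigidity: not predicted. Items at open: 6
(+ IR0 informal = 7); after the 2026-08-15 repair: 4 cruxes + 1 support (LSWRestrictionFact83) + IR0
informal, deciding theorem `closes` certified.

DEFINITION REQUESTS. RestrictionMarkovTangentSpace (topic
Literature/Probability/RandomPlanarGeometry): the graded space T_y(F) of first-order deformations
of a chordal family F inside the variety of exact (restriction, restriction-coupled Markov kernel,
reversibility, translation-covariance)
families — data: the derivative of the avoidance functionals of Jordan AND slit pairs plus the
derivative of the past-laws as functionals
on slit-domain avoidance functionals (tangent vectors to curves of mutually singular measures are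
distributions, not signed measures);
constraints: the linearised identities; grading by dilation weight y and spin. Filed with `--for`
the informal crux InfinitesimalRigidity
(IR0: T_0(SLE(8/3)) = sym₀(2)). Cite facts wanted: none (needs-fact: none — LSW03 is the proved
Literature.Probability.RandomPlanarGeometry.LawlerSchrammWerner2003_holds;
SLE(8/3) existence/uniqueness in law are the proved exists_isSLECurve_eightThirds /
IsSLECurve.map_eq_holds; no decl of this route
mentions the cite-only exists_isSLECurve, hasSLETrace_eight or tendsto_norm_sleTrace_atTop).

Novelty: Searches (2026-08-15): `lit frontier CriticalPhenomena --since 2021` (30 descendants; none on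
restriction/Markov rigidity or SLE
deformation theory); `lit bridges CriticalPhenomena --cross any` (30; none); `lit search --source
crossref "local rigidity restriction
measures self-avoiding walk scaling limit deformation"` (8: Slade 1989, Kennedy–Lawler 2013, LSW
2004 — none on rigidity);
`lit search --source zbmath "rigidity restriction property SLE"` (0) and `"domain Markov restriction
characterization SLE"` (0);
`lit search --source crossref "Virasoro module structure of local martingales"` (Kytola2007,
BauerBernard2003 PLB, Kytola2009, Dubédat
2005 — all conformal); `lit galaxy search "infinitesimal rigidity" --star all` (panama/pdf queue
timeout, crabby 0); openalex/arXiv/S2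
rate-limited this session; plus the card's own searches and the refuter novelty audit of 2026-08-15
(zbMATH ×6: Kytölä, Friedrich–Werner,
Doyon–Riva–Cardy, Baverez–Jego).
Nearest prior art found: Kytola2007 / BauerBernard2003 (arXiv:math-ph/0604047, hep-th/0210015:
first-order perturbations of SLE preserving
the CONFORMAL Markov structure = local martingales graded by L₀ into Virasoro modules);
FriedrichWerner2003 (doi:10.1007/s00220-003-0956-8:
highest-weight/hull-semigroup tangent action on restriction measures, conformal);
LawlerSchrammWerner2003Restriction (classification
with conformal invariance built in); Weil1964Rigidity (H¹ = 0 ⇒ local rigidity template); route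
SAWRestrictionRigidity (R*, global,  [refs: 10.1007/s00220-003-0956-8:, math-ph/0604047, doi:10.1007/s00220-003-0956-8, Kytola2007, BauerBernard2003, Kytola2009, FriedrichWerner2003]

Barriers (technique_class: infinitesimal-rigidity symmetry-upgrade): - technique_class: infinitesimal-rigidity symmetry-upgrade
- Literature.Barriers.CriticalPhenomena.ScaleCovarianceNotMoebius: its witness
(ScaleNotMoebius.witnessFamily) is a d = 3 correlation family with Euclidean + scale data only;
LocalRigidity upgrades a planar CURVE family carrying in addition exact two-sided restriction, the
restriction-coupled Markov kernel and reversibility, and only LOCALLY at SLE(8/3); the barrier's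
moral is honoured — the model-specific input is exact restriction/Markov, and the claim is
falsifiable by the nullity computation. Honest reading: GlobalFromLocal is a bare symmetry-upgrade
residue and could fail exactly as the barrier warns.
- Literature.Barriers.CriticalPhenomena.EmbeddingModulusUniqueness: embraced, not evaded — the
predicted weight-0 tangent space IS Beffara's linear modulus (sym₀(2)); the embedding-specific datum
is the Euclidean quarter-turn (k odd in z ↦ r·i^k·z + w) inside the hypotheses, acting by −1 on
sym₀(2), so on a sheared lattice L·ℤ² the same argument pins L_*SLE(8/3), consistent with
Beffara2008Universal Prop. 4.
- Literature.Barriers.CriticalPhenomena.SAWNoUnitaryCFT: a warning, not an obstruction — no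
positivity/unitarity is used; the c = 0 logarithmic partner of the stress tensor is why the weight-0
space must be taken with generalised eigenvectors (possible Jordan block), recorded in
LocalRigidity's why-might-fail.
- Literature.Barriers.CriticalPhenomena.SupercriticalSAWSpaceFilling: consistent and used as sanity
— t

History (route lifecycle, newest last):
- 2026-08-15T16:17:40Z · rev 2: restated Assembly (stmt-CriticalPhenomena-4618) — route-repair (glue) step 2/2: deciding theorem `closes : LocalRigidity → GlobalFromLocal → AxiomsOfLimit → LimitExists → LSWRestrictionFact83 → SAWScalingLimit` (planner-rbadge-CriticalPhenomena-SAWInfinitesi-6ed5d7e8-g4-0)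
- 2026-08-15T16:17:40Z · rev 2: dropped LSWRestrictionFact — route-repair (glue) step 2/2: deciding theorem `closes : LocalRigidity → GlobalFromLocal → AxiomsOfLimit → LimitExists → LSWRestrictionFact83 → SAWScalingLimit` (planner-rbadge-CriticalPhenomena-SAWInfinitesi-6ed5d7e8-g4-0)

sub-problem: SAWScalingLimit · status: open · opened planner-plancard-CriticalPhenomena-SAWScaling-b3aa2bc6-0 2026-08-15T11:34:38Z · rev 2 · ledger route-CriticalPhenomena-SAWInfinitesimalRigidity
GENERATED by the gate from the ledger (D-0016/17). Provers cite these decls: `theorem foo : Summit.CriticalPhenomena.SAWScalingLimit.Theses.SAWInfinitesimalRigidity.<Decl> := …` in Summits/CriticalPhenomena/SAWScalingLimit/Theorems/<Name>.lean.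
-/

namespace Summit.CriticalPhenomena.SAWScalingLimit.Theses.SAWInfinitesimalRigidity

open scoped BigOperators Topology Manifold Classical MeasureTheory ProbabilityTheory Matrix InnerProductSpace ComplexConjugate ContinuousMap
open Filter Set Function TopologicalSpace MeasureTheory

attribute [summit_statement] _root_.SAWScalingLimit

/-- item stmt-CriticalPhenomena-4616 · crux · rank 2 · open · by planner
why it might fail: An exotic weight-0 restriction–Markov cocycle at SLE(8/3) may exist and integrate (T_0 never computed); the c=0 log-partner of the stress tensor may put a Jordan block at weight 0; the sup-avoidance topology may lose derivatives so no implicit-function argument closes.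
sources: LawlerSchrammWerner2003Restriction, FriedrichWerner2003, BauerBernard2003, Kytola2007, Weil1964Rigidity, Hamilton1982NashMoser
[crux] LOCAL RIGIDITY of SLE(8/3) (card items IR0 + LocalRigidity, conclusion form): for every
chordal family F all of whose laws are chordal SLE(8/3) laws there is ε > 0 such that every chordal
family P that is chordal, has two-sided restriction, a restriction-coupled domain Markov kernel, is
reversible, is covariant under z ↦ r·i^k·z + w (r > 0, k ∈ ℕ, w ∈ ℂ) and under conjugation, is
carried by simple curves meeting ∂D only at a, b (the hypotheses of stmt-CriticalPhenomena-1368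
verbatim), AND satisfies sup over nested Dobrushin pairs D' ⊆ D (same marked points) of |P D {γ ⊆ cl
D'} − F D {γ ⊆ cl D'}| ≤ ε, is conformally covariant. Intended proof: tangent space at F in weight 0
= sym₀(2) (IR0, filed informally after open), quarter-turn acts by −1 on it, implicit function
theorem on the axiom variety. [difficulty: XL] -/
@[route_item "route-CriticalPhenomena-SAWInfinitesimalRigidity", crux]
def LocalRigidity : Prop :=
  ∀ F : Literature.Probability.RandomPlanarGeometry.ChordalFamily, (∀ D : Literature.Probability.RandomPlanarGeometry.DobrushinDomain, Literature.Probability.RandomPlanarGeometry.IsSLELaw ((8 : NNReal) / 3) D (F D)) → ∃ ε : ℝ, 0 < ε ∧ ∀ P : Literature.Probability.RandomPlanarGeometry.ChordalFamily, P.IsChordal → P.IsRestriction → (∃ Q : Literature.Probability.RandomPlanarGeometry.DobrushinDomain → Literature.Probability.RandomPlanarGeometry.CurveClass ℂ → MeasureTheory.Measure (Literature.Probability.RandomPlanarGeometry.CurveClass ℂ), P.IsMarkovExtension Q ∧ ∀ (D : Literature.Probability.RandomPlanarGeometry.DobrushinDomain) (p : Literature.Probability.RandomPlanarGeometry.CurveClass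 ℂ) (D' : Literature.Probability.RandomPlanarGeometry.DobrushinDomain), D'.carrier ⊆ Literature.Probability.RandomPlanarGeometry.remainingDomain D p → D'.pt 0 = p.target → D'.pt 1 = D.pt 1 → ∀ T : Set (Literature.Probability.RandomPlanarGeometry.CurveClass ℂ), MeasurableSet T → P D' T * Q D p (Literature.Probability.RandomPlanarGeometry.CurveClass.rangeSubset (closure D'.carrier)) = Q D p (T ∩ Literature.Probability.RandomPlanarGeometry.CurveClass.rangeSubset (closure D'.carrier))) → (∀ D D' : Literature.Probability.RandomPlanarGeometry.DobrushinDomain, D'.carrier = D.carrier → D'.pt 0 = D.pt 1 → D'.pt 1 = D.pt 0 → P D' = (P D).map Literature.Probability.RandomPlanarGeometry.CurveClass.reverse) → (∀ (D : Literature.Probability.RandomPlanarGeometry.DobrushinDomain) (c : ℂ) (hc : c ≠ 0) (w : ℂ), (∃ (r : ℝ) (k : ℕ), 0 < r ∧ c = (r : ℂ) * Complex.I ^ k) → P (D.map (Literature.Probability.RandomPlanarGeometry.similarity c hc w)) = (P D).map (Literature.Probability.RandomPlanarGeometry.CurveClass.map (Literature.Probability.RandomPlanarGeometry.similarity c hc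 w : C(ℂ, ℂ)))) → (∀ D : Literature.Probability.RandomPlanarGeometry.DobrushinDomain, P (D.map Complex.conjLIE.toHomeomorph) = (P D).map (Literature.Probability.RandomPlanarGeometry.CurveClass.map (Complex.conjLIE.toHomeomorph : C(ℂ, ℂ)))) → (∀ D : Literature.Probability.RandomPlanarGeometry.DobrushinDomain, ∀ᵐ γ ∂(P D), γ ∈ Literature.Probability.RandomPlanarGeometry.CurveClass.simple ∧ γ.range ∩ frontier D.carrier ⊆ {D.pt 0, D.pt 1}) → (∀ D D' : Literature.Probability.RandomPlanarGeometry.DobrushinDomain, D'.carrier ⊆ D.carrier → D'.pt 0 = D.pt 0 → D'.pt 1 = D.pt 1 → |(P D (Literature.Probability.RandomPlanarGeometry.CurveClass.rangeSubset (closure D'.carrier))).toReal - (F D (Literature.Probability.RandomPlanarGeometry.CurveClass.rangeSubset (closure D'.carrier))).toReal| ≤ ε) → P.IsConformallyCovariant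

/-- item stmt-CriticalPhenomena-4617 · crux · rank 4 · open · by planner
why it might fail: No mechanism: local rigidity gives no handle on solution components far from SLE(8/3); one anisotropic restriction–Markov family with all lattice symmetries (¬R*, stmt-1368) refutes it while LocalRigidity survives.
sources: LawlerSchrammWerner2003Restriction, Beffara2008Universal, Werner2007, LawlerSchrammWerner2004SAW
[crux] the global residue: LocalRigidity implies R* — every chordal family with the lattice-exact
axioms (hypotheses of stmt-CriticalPhenomena-1368 verbatim: chordal, restriction,
restriction-coupled Markov kernel, reversible, lattice-similarity and conjugation covariant, simple
boundary-avoiding) is conformally covariant. Equivalent, given LocalRigidity, to "the D4-symmetric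
axiom variety has no component away from SLE(8/3)"; this route claims no mechanism for it and states
it so that R* = LocalRigidity ∧ GlobalFromLocal is decomposed honestly (rank 3 is reserved for the
informal engine IR0 filed right after open). [deps: LocalRigidity] [difficulty: open-problem] -/
@[route_item "route-CriticalPhenomena-SAWInfinitesimalRigidity", crux]
def GlobalFromLocal : Prop :=
  LocalRigidity → ∀ P : Literature.Probability.RandomPlanarGeometry.ChordalFamily, P.IsChordal → P.IsRestriction → (∃ Q : Literature.Probability.RandomPlanarGeometry.DobrushinDomain → Literature.Probability.RandomPlanarGeometry.CurveClass ℂ → MeasureTheory.Measure (Literature.Probability.RandomPlanarGeometry.CurveClass ℂ), P.IsMarkovExtension Q ∧ ∀ (D : Literature.Probability.RandomPlanarGeometry.DobrushinDomain) (p : Literature.Probability.RandomPlanarGeometry.CurveClass ℂ) (D' : Literature.Probability.RandomPlanarGeometry.DobrushinDomain), D'.carrier ⊆ Literature.Probability.RandomPlanarGeometry.remainingDomain D p → D'.pt 0 = p.target → D'.pt 1 = D.pt 1 → ∀ T : Set (Literature.Probability.RandomPlanarGeometry.CurveClass ℂ), MeasurableSet T → P D' T * Q D p (Literature.Probability.RandomPlanarGeometry.CurveClass.rangeSubset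 (closure D'.carrier)) = Q D p (T ∩ Literature.Probability.RandomPlanarGeometry.CurveClass.rangeSubset (closure D'.carrier))) → (∀ D D' : Literature.Probability.RandomPlanarGeometry.DobrushinDomain, D'.carrier = D.carrier → D'.pt 0 = D.pt 1 → D'.pt 1 = D.pt 0 → P D' = (P D).map Literature.Probability.RandomPlanarGeometry.CurveClass.reverse) → (∀ (D : Literature.Probability.RandomPlanarGeometry.DobrushinDomain) (c : ℂ) (hc : c ≠ 0) (w : ℂ), (∃ (r : ℝ) (k : ℕ), 0 < r ∧ c = (r : ℂ) * Complex.I ^ k) → P (D.map (Literature.Probability.RandomPlanarGeometry.similarity c hc w)) = (P D).map (Literature.Probability.RandomPlanarGeometry.CurveClass.map (Literature.Probability.RandomPlanarGeometry.similarity c hc w : C(ℂ, ℂ)))) → (∀ D : Literature.Probability.RandomPlanarGeometry.DobrushinDomain, P (D.map Complex.conjLIE.toHomeomorph) = (P D).map (Literature.Probability.RandomPlanarGeometry.CurveClass.map (Complex.conjLIE.toHomeomorph : C(ℂ, ℂ)))) → (∀ D : Literature.Probability.RandomPlanarGeometry.DobrushinDomain, ∀ᵐ γ ∂(P D), γ ∈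 Literature.Probability.RandomPlanarGeometry.CurveClass.simple ∧ γ.range ∩ frontier D.carrier ⊆ {D.pt 0, D.pt 1}) → P.IsConformallyCovariant

/-- item stmt-CriticalPhenomena-1370 · crux · rank 5 · open · by planner
why it might fail: Markov passage needs stability of SAW limits in slit domains perturbed near the tip (beyond (lim) on Jordan domains); simplicity/boundary avoidance need no-crawling estimates not in print; restriction passage needs null touching; largest-component bookkeeping.
sources: LawlerSchrammWerner2004SAW, Werner2007, KennedyLawler2013, DuminilCopinHammond2013
[crux] every chordal family P that is the full scaling limit (lim) of the critical δℤ² SAW laws —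
for every Dobrushin domain and EVERY endpoint approximation (SAW.IsEndpointApprox) — satisfies the
hypotheses of Rigidity: restriction (exact lattice identity, LSW04 §3.4.5; portmanteau on the closed
event range ⊆ closure D' plus null touching), restriction-coupled Markov (conditional future given a
lattice past = SAW of the slit graph; its conditioning into a Jordan subdomain = SAW there),
reversibility (exact), covariance under z ↦ r·i^k·z + w and conjugation (quarter-turn/conjugation
exact at each δ; dilations via (λΩ)_δ = λ·Ω_{δ/λ} and the full-filter limit; translations:
axis-parallel w lies in δ_nℤ² along δ_n = |w|/n, then compose — no continuity in D needed),
simplicity and boundary avoidance. Sources: LawlerSchrammWerner2004SAW (arXiv:math/0204277 §3.4.5,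
p.14), Werner2007 §3.2, KennedyLawler2013, DuminilCopinHammond2013. -/
@[route_item "route-CriticalPhenomena-SAWInfinitesimalRigidity", crux]
def AxiomsOfLimit : Prop :=
  ∀ P : Literature.Probability.RandomPlanarGeometry.ChordalFamily, P.IsChordal → (∀ (D : Literature.Probability.RandomPlanarGeometry.DobrushinDomain) (a b : ℝ → Literature.Probability.LatticeModels.Site 2), Literature.Probability.RandomPlanarGeometry.SAW.IsEndpointApprox D a b → Literature.Probability.RandomPlanarGeometry.TendstoLaw (fun δ (γ : Literature.Probability.RandomPlanarGeometry.SAW.DomainSAW D.carrier δ (a δ) (b δ)) => γ.curve) (fun δ => Literature.Probability.RandomPlanarGeometry.SAW.law D.carrier δ (a δ) (b δ)) id (P D)) → P.IsRestriction ∧ (∃ Q : Literature.Probability.RandomPlanarGeometry.DobrushinDomain → Literature.Probability.RandomPlanarGeometry.CurveClass ℂ → MeasureTheory.Measure (Literature.Probability.RandomPlanarGeometry.CurveClass ℂ), P.IsMarkovExtension Q ∧ ∀ (D : Literature.Probability.RandomPlanarGeometry.DobrushinDomain) (p : Literature.Probability.RandomPlanarGeometry.CurveClass ℂ) (D' : Literature.Probability.RandomPlanarGeometry.DobrushinDomain),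 D'.carrier ⊆ Literature.Probability.RandomPlanarGeometry.remainingDomain D p → D'.pt 0 = p.target → D'.pt 1 = D.pt 1 → ∀ T : Set (Literature.Probability.RandomPlanarGeometry.CurveClass ℂ), MeasurableSet T → P D' T * Q D p (Literature.Probability.RandomPlanarGeometry.CurveClass.rangeSubset (closure D'.carrier)) = Q D p (T ∩ Literature.Probability.RandomPlanarGeometry.CurveClass.rangeSubset (closure D'.carrier))) ∧ (∀ D D' : Literature.Probability.RandomPlanarGeometry.DobrushinDomain, D'.carrier = D.carrier → D'.pt 0 = D.pt 1 → D'.pt 1 = D.pt 0 → P D' = (P D).map Literature.Probability.RandomPlanarGeometry.CurveClass.reverse) ∧ (∀ (D : Literature.Probability.RandomPlanarGeometry.DobrushinDomain) (c : ℂ) (hc : c ≠ 0) (w : ℂ), (∃ (r : ℝ) (k : ℕ), 0 < r ∧ c = (r : ℂ) * Complex.I ^ k) → P (D.map (Literature.Probability.RandomPlanarGeometry.similarity c hc w)) = (P D).map (Literature.Probability.RandomPlanarGeometry.CurveClass.map (Literature.Probability.RandomPlanarGeometry.similarity c hc w : C(ℂ, ℂ)))) ∧ (∀ D : Literature.Probability.RandomPlanarGeometry.DobrushinDomain,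 P (D.map Complex.conjLIE.toHomeomorph) = (P D).map (Literature.Probability.RandomPlanarGeometry.CurveClass.map (Complex.conjLIE.toHomeomorph : C(ℂ, ℂ)))) ∧ (∀ D : Literature.Probability.RandomPlanarGeometry.DobrushinDomain, ∀ᵐ γ ∂(P D), γ ∈ Literature.Probability.RandomPlanarGeometry.CurveClass.simple ∧ γ.range ∩ frontier D.carrier ⊆ {D.pt 0, D.pt 1})

/-- item stmt-CriticalPhenomena-1371 · crux · rank 6 · open · by planner
why it might fail: Eventual tightness of critical SAW is open (no annulus-crossing bound at x_c); uniqueness of subsequential limits rests on an avoidance-cocycle limit; an approximation-dependent limit (Kennedy–Lawler boundary effects) would refute the conjunct itself as typed.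
sources: LawlerSchrammWerner2004SAW, KemppainenSmirnov2017, AizenmanBurchardDuke1999, DuminilCopinHammond2013, KennedyLawler2013
[crux] existence of the full scaling limit of the critical δℤ² SAW as a chordal curve family: ∃ P,
P.IsChordal ∧ (lim) for every Dobrushin domain and every endpoint approximation (the limit is NOT
identified here). Planned glued split (tenure): EventualTight ∧ simple boundary-avoiding
subsequential limits; uniqueness of subsequential limits from AvoidanceCocycleLimit +
AvoidanceDeterminesLaw; diagonal extraction over a countable dense class of domains. Sources:
LawlerSchrammWerner2004SAW (arXiv:math/0204277 p.3 'we do not know how to prove the existence of the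
limit'), KemppainenSmirnov2017 (arXiv:1212.6215 Thm 1.5), AizenmanBurchardDuke1999,
DuminilCopinHammond2013 (arXiv:1205.0401). -/
@[route_item "route-CriticalPhenomena-SAWInfinitesimalRigidity", crux]
def LimitExists : Prop :=
  ∃ P : Literature.Probability.RandomPlanarGeometry.ChordalFamily, P.IsChordal ∧ (∀ (D : Literature.Probability.RandomPlanarGeometry.DobrushinDomain) (a b : ℝ → Literature.Probability.LatticeModels.Site 2), Literature.Probability.RandomPlanarGeometry.SAW.IsEndpointApprox D a b → Literature.Probability.RandomPlanarGeometry.TendstoLaw (fun δ (γ : Literature.Probability.RandomPlanarGeometry.SAW.DomainSAW D.carrier δ (a δ) (b δ)) => γ.curve) (fun δ => Literature.Probability.RandomPlanarGeometry.SAW.law D.carrier δ (a δ) (b δ)) id (P D))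

-- item stmt-CriticalPhenomena-5236 · support · rank 3 · open · by planner — informal only, no Lean statement yet:
--   [crux] IR0 — GRADED INFINITESIMAL RIGIDITY at weight 0 (card graded-infinitesimal-rigidity, item
--   (1)), the engine behind LocalRigidity: let 𝒱 be the variety of chordal families Q on Dobrushin
--   domains together with their restriction-coupled Markov kernels (extension to slit domains)
--   satisfying EXACTLY two-sided restriction, the restriction-kernel identity, reversibility and
--   translation covariance, carried by simple boundary-avoiding curves; the chordal SLE(8/3) family F is
--   a fixed point of the dilation action on 𝒱. Let T_0 be the space of dilation-invariant first-order
--   deformations of F inside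

/-- item stmt-CriticalPhenomena-3017 · support · rank 9 · closed · proved by Summit.CriticalPhenomena.SAWScalingLimit.Theorems.LSWSimpleRestrictionIsSLE_proof @ db6b0749abc7 (prover) · by planner
[support] LSW03 classification in HYPOTHESIS-FREE form (route repair 2026-08-15; implies the shared
item stmt-CriticalPhenomena-0775 = LSWRestrictionFact verbatim, see planner Sketch.lean
`lsw_new_implies_old`): a chordal family on Dobrushin domains that is chordal, conformally covariant
(ChordalFamily.IsConformallyCovariant), has the two-sided restriction property
(ChordalFamily.IsRestriction) and is carried by simple curves meeting ∂D only at the two marked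
points is, in every domain, the chordal SLE_{8/3} law (IsSLELaw (8/3)). The named-fact hypotheses of
stmt-0775 are dropped because they are not needed at κ = 8/3: existence is the library THEOREM
Literature.Probability.RandomPlanarGeometry.exists_isSLECurve_eightThirds (SLEExistenceNeEightHolds;
Rohde–Schramm Thm 5.1 + Thm 7.1; axiom closure propext/choice/Quot.sound checked), uniqueness in law
is IsSLECurve.map_eq_holds (SLEUniquenessInLaw); `exists_isSLECurve` for ALL κ is equivalent to the
unproved SLE₈ trace theorem (hasSLETrace_eight, SLETransienceIffTrace) and must not burden an
SLE_{8/3} route. Sources: LawlerSchrammWerner2003Restriction (arXiv:math/0209343: p.5 results 1–2,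
Prop. 3.3, Thm 6.1, Cor. 8.6), RohdeSchramm20 -/
@[route_item "route-CriticalPhenomena-SAWInfinitesimalRigidity", crux]
def LSWRestrictionFact83 : Prop :=
  ∀ P : Literature.Probability.RandomPlanarGeometry.ChordalFamily, P.IsChordal → P.IsConformallyCovariant → P.IsRestriction → (∀ D : Literature.Probability.RandomPlanarGeometry.DobrushinDomain, ∀ᵐ γ ∂(P D), γ ∈ Literature.Probability.RandomPlanarGeometry.CurveClass.simple ∧ γ.range ∩ frontier D.carrier ⊆ {D.pt 0, D.pt 1}) → ∀ D : Literature.Probability.RandomPlanarGeometry.DobrushinDomain, Literature.Probability.RandomPlanarGeometry.IsSLELaw ((8 : NNReal) / 3) D (P D)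

-- earlier Assembly (stmt-CriticalPhenomena-4618, replaced 2026-08-15T16:17:40Z -> stmt-CriticalPhenomena-10515): retired by None — Literature.Probability.RandomPlanarGeometry.exists_isSLECurve → Literature.Probability.RandomPlanarGeometry.IsSLECurve.map_eq → LSWRestrictionFact → LocalRigidity → GlobalFromLocal → LimitExists → AxiomsOfLimit → SAWScalingLimit
/-- item stmt-CriticalPhenomena-10515 · assembly · rank 1 · closed · proved by Summit.CriticalPhenomena.SAWScalingLimit.Theorems.sawInfinitesimalRigidity_assembly_proof @ 44e175075bcb (prover) · by planner
sources: LawlerSchrammWerner2003Restriction, LawlerSchrammWerner2004SAW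
[assembly] LocalRigidity → GlobalFromLocal → AxiomsOfLimit → LimitExists → LSWRestrictionFact83 →
SAWScalingLimit (route repair 2026-08-15: the named facts exists_isSLECurve / IsSLECurve.map_eq and
the item LSWRestrictionFact = stmt-0775 are no longer in front; the LSW03 input is the
hypothesis-free shared item LSWRestrictionFact83 = stmt-3017). This is literally the type of the
route's certified deciding theorem `closes` (same file), so it is PROVABLE NOW by `exact closes` in
a Theorems file: take P from LimitExists; AxiomsOfLimit gives restriction, restriction-coupled
Markov kernel, reversal, lattice-similarity + conjugation covariance, simplicity; GlobalFromLocal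
applied to LocalRigidity gives P.IsConformallyCovariant; LSWRestrictionFact83 gives IsSLELaw (8/3) D
(P D) = law of an SLE curve Γ; MeasureTheory.integral_map turns TendstoLaw … id (P D) into
TendstoLaw … Γ preWienerMeasure; the measurability clause is SAW.aemeasurable_curve. [difficulty:
provable-now] -/
@[route_item "route-CriticalPhenomena-SAWInfinitesimalRigidity"]
def Assembly : Prop :=
  LocalRigidity → GlobalFromLocal → AxiomsOfLimit → LimitExists → LSWRestrictionFact83 → SAWScalingLimit

/-! D-0027 §2.1 — DECIDING THEOREM (planner-authored via `route open/edit --closes-file`; by planner-rbadge-CriticalPhenomena-SAWInfinitesi-6ed5d7e8-g4-0 2026-08-15T16:17:40Z):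
its hypotheses are this route's items and its conclusion the sub-problem Statement (glue_lint), and it elaborates with this file. -/

@[closes "route-CriticalPhenomena-SAWInfinitesimalRigidity"] theorem closes (h₁ : LocalRigidity) (h₂ : GlobalFromLocal) (h₃ : AxiomsOfLimit) (h₄ : LimitExists)
    (h₅ : LSWRestrictionFact83) : _root_.SAWScalingLimit := by
  -- D-0027 §2.1 deciding theorem: pure logic plus `MeasureTheory.integral_map`.
  -- The full scaling limit `P` of the critical SAW laws (LimitExists) …
  obtain ⟨P, hP, hlim⟩ := h₄
  -- … inherits restriction, the restriction-coupled Markov kernel, reversibility,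
  -- lattice-similarity and conjugation covariance, simplicity (AxiomsOfLimit) …
  obtain ⟨hres, hmark, hrev, hsim, hconj, hsimple⟩ := h₃ P hP hlim
  -- … hence is conformally covariant (GlobalFromLocal fed LocalRigidity = R*) …
  have hcc : P.IsConformallyCovariant := h₂ h₁ P hP hres hmark hrev hsim hconj hsimple
  -- SAWScalingLimit = ∀ D a b, IsEndpointApprox D a b → ConvergesInLawToSLE (8/3) D curve law.
  intro D a b hab
  -- … hence `P D` is the chordal SLE_{8/3} law (LSWRestrictionFact83), the law of an SLE curve Γ.
  obtain ⟨Γ, hΓ, hPD⟩ := h₅ P hP hcc hres hsimple D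
  refine ⟨Γ, hΓ, Filter.Eventually.of_forall fun δ =>
    Literature.Probability.RandomPlanarGeometry.SAW.aemeasurable_curve _ _ _ _, fun f => ?_⟩
  -- TendstoLaw … id (P D) with P D = preWienerMeasure.map Γ is TendstoLaw … Γ preWienerMeasure.
  have h := hlim D a b hab f
  have key : (∫ ω, f (id ω) ∂(P D)) =
      ∫ ω, f (Γ ω) ∂(Literature.Probability.Process.preWienerMeasure) := by
    rw [hPD]
    exact MeasureTheory.integral_map hΓ.aemeasurable f.continuous.aestronglyMeasurable
  rw [key] at h
  exact h

end Summit.CriticalPhenomena.SAWScalingLimit.Theses.SAWInfinitesimalRigidity
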